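import Mathlib
import Summits.MatrixMultiplication.MatrixMultiplication.Theorems.OctonionicLaserDefs
import Summits.MatrixMultiplication.MatrixMultiplication.Theorems.OctonionicLaserOctKoszulFourteen
import Literature.Computability.AlgebraicComplexity.AsymptoticSpectrum

/-!
# `OctAsymptoticRank` (stmt-MatrixMultiplication-7930), line `birth` — stub `stub_octonionBasis`:
# the octonion-basis transfer `𝕊 ≥ t₈`

What.  The registered stub `stub_octonionBasis` of the skeleton
`Cruxes/OctAsymptoticRank/Lines/birth.lean`: the signed `𝔽₂³` multiplication table of the octonions,
`𝕊 z x y = [z = x + y] · (−1)^{f(x,y)}` on `𝔽₂³ = Fin 2 × Fin 2 × Fin 2`, with the Albuquerque–Majid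
cocycle `f(x,y) = Σ_{i ≤ j} xᵢ yⱼ + y₁x₂x₃ + x₁y₂x₃ + x₁x₂y₃` (so `e_x e_y = (−1)^{f(x,y)} e_{x+y}` is an
octonion algebra), RESTRICTS (`Literature.Computability.AlgebraicComplexity.TensorRestrictsTo`,
Christandl–Vrana–Zuiddam §1.1: `s a' b' c' = ∑ A a' a · B b' b · C c' c · t a b c`) to the route's
tensor `t₈ = octT ℂ` of `Theorems/OctonionicLaserDefs.lean` — the structure tensor of the complex
octonions written as the Cayley–Dickson double of `M₂(ℂ)` with the adjugate involution (first slot the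
output).  In the skeleton this is the dictionary that moves the asymptotic-rank bound from `𝕊` to `t₈`
(monotonicity of `R̃` under restriction).

How.  An explicit restriction `octT ℂ o p q = ∑_{z,x,y} A o z · B p x · C q y · 𝕊 z x y` with
`A o z = M⁻¹[o, z]`, `B p x = M[x, p]`, `C q y = M[y, q]`, where `M` (entries in `{0, ±1/2, ±i/2}`) is the
matrix of the algebra isomorphism from the `𝕊`-basis `(e_z)` to the graded matrix units of `t₈`
determined by `I = e₀₀₁`, `J = e₀₁₀`, `L = e₁₀₀`, `E₀₀ = (1 − iI)/2`, `E₁₁ = (1 + iI)/2`,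
`E₀₁ = E₀₀ J E₁₁`, `E₁₀ = −E₁₁ J E₀₀`, `(0; E_{ij}) ↦ E_{ij}`, `(1; E_{ij}) ↦ E_{ij} L`.  All data are kept
over the Gaussian integers `ℤ[i]` (`GaussianInt`) as the local notations `tabA = M⁻¹` and `tab2M = 2M`
(both indexed through `octEnc`), and the identity with denominators cleared and the `z`-sum already
collapsed against `[z = x + y]`,

  `4 · octTab o p q = ∑_{x,y} M⁻¹[o, x + y] · 2M[x, p] · 2M[y, q] · (−1)^{f(x,y)}`      (`key64`),

is checked by the kernel (`decide +kernel`: `512` Gaussian-integer identities of `64` terms each; no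
compiled evaluation is trusted), `octTab = octT ℤ` being the closed form proved in
`OctonionicLaserOctKoszulFourteen.lean` (`octT_int_eq_octTab`).  The complex statement follows by the
sum bookkeeping `sum_collapse_graph`, the ring homomorphism `GaussianInt.toComplex : ℤ[i] →+* ℂ`
(the witnesses are `tabA` and `tab2M / 2` read in `ℂ`) and base change `octT_map (Int.castRingHom ℂ)`
(`octT_complex_eq_octTab`).  The file declares no definition.

Sources: H. Albuquerque, S. Majid, *Quasialgebra structure of the octonions*, J. Algebra 220 (1999),
Prop. 3.1 [AlbuquerqueMajid1999] (the cocycle `f`, `𝕆 ≅ k_F[ℤ₂³]`); R. D. Schafer, *An introduction to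
nonassociative algebras* (1966), Ch. III §4 (Cayley–Dickson process, the split octonions as the double
of `M₂`); M. Christandl, P. Vrana, J. Zuiddam, J. Amer. Math. Soc. 36 (2023), §1.1 (restriction
preorder) [ChristandlVranaZuiddam2023].  Nothing is cited as a fact: the file proves an explicit finite
identity.
-/

-- single-conjunct summit: the mandated namespace repeats MatrixMultiplication.
set_option linter.dupNamespace false

namespace Summit.MatrixMultiplication.MatrixMultiplication.Theorems

namespace OctAsymptoticRank

open Literature.Computability.AlgebraicComplexity
open Summit.MatrixMultiplication.MatrixMultiplication.Theorems.OctonionicLaser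
  (octT octEnc octTab octT_map octT_int_eq_octTab)

/-! ## The data over the Gaussian integers (local notations; no definitions are declared) -/

/-- The imaginary unit `i = ⟨0, 1⟩` of the Gaussian integers `ℤ[i]`. -/
local notation "𝒊" => (⟨0, 1⟩ : GaussianInt)

/-- `tabA = M⁻¹` (rows: the output index `o` of `t₈`; columns: `z ∈ 𝔽₂³`; both encoded by `octEnc`),
entries in `{0, ±1, ±i}`. -/
local notation "tabA" =>
  (![![1, 𝒊, 0, 0, 0, 0, 0, 0],
     ![0, 0, 1, 𝒊, 0, 0, 0, 0],
     ![0, 0, -1, 𝒊, 0, 0, 0, 0],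
     ![1, -𝒊, 0, 0, 0, 0, 0, 0],
     ![0, 0, 0, 0, 1, 𝒊, 0, 0],
     ![0, 0, 0, 0, 0, 0, 1, -𝒊],
     ![0, 0, 0, 0, 0, 0, -1, -𝒊],
     ![0, 0, 0, 0, 1, -𝒊, 0, 0]] : Fin 8 → Fin 8 → GaussianInt)

/-- `tab2M = 2M` (rows: `z ∈ 𝔽₂³`; columns: an input index `p` of `t₈`; both encoded by `octEnc`),
`M` the matrix of the isomorphism of the module docstring; entries in `{0, ±1, ±i}`. -/
local notation "tab2M" =>
  (![![1, 0, 0, 1, 0, 0, 0, 0],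
     ![-𝒊, 0, 0, 𝒊, 0, 0, 0, 0],
     ![0, 1, -1, 0, 0, 0, 0, 0],
     ![0, -𝒊, -𝒊, 0, 0, 0, 0, 0],
     ![0, 0, 0, 0, 1, 0, 0, 1],
     ![0, 0, 0, 0, -𝒊, 0, 0, 𝒊],
     ![0, 0, 0, 0, 0, 1, -1, 0],
     ![0, 0, 0, 0, 0, 𝒊, 𝒊, 0]] : Fin 8 → Fin 8 → GaussianInt)

set_option maxHeartbeats 4000000 in
/-- **The integer-side certificate** (kernel evaluation of `512` Gaussian-integer identities of `64`
terms each): `4 · octTab o p q = ∑_{x,y} M⁻¹[o, x + y] · 2M[x, p] · 2M[y, q] · (−1)^{f(x,y)}`, the sign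
`(−1)^{f(x,y)}` of the Albuquerque–Majid cocycle being written with the boolean condition of the
registered stub. [folklore] -/
theorem key64 : ∀ o p q : Fin 2 × Fin 2 × Fin 2,
    4 * (octTab o p q : GaussianInt) =
      ∑ x : Fin 2 × Fin 2 × Fin 2, ∑ y : Fin 2 × Fin 2 × Fin 2,
        tabA (octEnc o) (octEnc (x + y)) * tab2M (octEnc x) (octEnc p) * tab2M (octEnc y) (octEnc q) *
          (if x.1 * y.1 + x.1 * y.2.1 + x.1 * y.2.2 + x.2.1 * y.2.1 + x.2.1 * y.2.2 + x.2.2 * y.2.2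
                + y.1 * x.2.1 * x.2.2 + x.1 * y.2.1 * x.2.2 + x.1 * x.2.1 * y.2.2 = (1 : Fin 2)
            then (-1 : GaussianInt) else (1 : GaussianInt)) := by
  decide +kernel

/-! ## Bookkeeping -/

/-- Collapsing a triple sum against the graph of addition:
`∑_{z,x,y} a z · b x · c y · [z = x + y] s x y = ∑_{x,y} a (x + y) · b x · c y · s x y`. [folklore] -/
theorem sum_collapse_graph {ι R : Type*} [Fintype ι] [DecidableEq ι] [Add ι] [Semiring R]
    (a b c : ι → R) (s : ι → ι → R) :
    ∑ z, ∑ x, ∑ y, a z * b x * c y * (if z = x + y then s x y else 0) =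
      ∑ x, ∑ y, a (x + y) * b x * c y * s x y :=
  calc ∑ z, ∑ x, ∑ y, a z * b x * c y * (if z = x + y then s x y else 0)
      = ∑ x, ∑ z, ∑ y, a z * b x * c y * (if z = x + y then s x y else 0) := Finset.sum_comm
    _ = ∑ x, ∑ y, ∑ z, a z * b x * c y * (if z = x + y then s x y else 0) :=
        Finset.sum_congr rfl fun _ _ => Finset.sum_comm
    _ = ∑ x, ∑ y, a (x + y) * b x * c y * s x y := by
        refine Finset.sum_congr rfl fun x _ => Finset.sum_congr rfl fun y _ => ?_
        simp only [mul_ite, mul_zero, Finset.sum_ite_eq', Finset.mem_univ, if_true]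

/-- `t₈` over `ℂ` is the integer table `octTab` read in `ℂ` (base change `octT_map` and the closed form
`octT_int_eq_octTab`). [folklore] -/
theorem octT_complex_eq_octTab (o p q : Fin 2 × Fin 2 × Fin 2) :
    octT ℂ o p q = ((octTab o p q : ℤ) : ℂ) := by
  rw [← octT_map (Int.castRingHom ℂ) o p q, octT_int_eq_octTab, eq_intCast]

/-! ## The stub -/

/-- **Stub `stub_octonionBasis` — the octonion-basis transfer `𝕊 ≥ t₈`.**  The signed `𝔽₂³`
multiplication table `𝕊 z x y = [z = x + y] · (−1)^{f(x,y)}` of the octonions (Albuquerque–Majid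
cocycle `f`, J. Algebra 220 (1999) Prop. 3.1; Schafer 1966 Ch. III §4) restricts to the route's
complex-octonion tensor `t₈ = octT ℂ`: `octT ℂ o p q = ∑_{z,x,y} A o z · B p x · C q y · 𝕊 z x y` with the
witnesses `A o z = M⁻¹[o, z] = tabA`, `B p x = M[x, p] = tab2M / 2`, `C q y = M[y, q] = tab2M / 2` read in
`ℂ` through `GaussianInt.toComplex`; entrywise the identity is `sum_collapse_graph`, the kernel
certificate `key64` mapped to `ℂ`, and `octT_complex_eq_octTab`. [folklore] -/
theorem stub_octonionBasis :
    Literature.Computability.AlgebraicComplexity.TensorRestrictsTo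
      (fun z x y : Fin 2 × Fin 2 × Fin 2 =>
        if z = x + y then
          (if x.1 * y.1 + x.1 * y.2.1 + x.1 * y.2.2 + x.2.1 * y.2.1 + x.2.1 * y.2.2 + x.2.2 * y.2.2
                + y.1 * x.2.1 * x.2.2 + x.1 * y.2.1 * x.2.2 + x.1 * x.2.1 * y.2.2 = (1 : Fin 2)
            then (-1 : ℂ) else (1 : ℂ))
        else (0 : ℂ))
      (Summit.MatrixMultiplication.MatrixMultiplication.Theorems.OctonionicLaser.octT ℂ) := by
  refine ⟨fun o z => GaussianInt.toComplex (tabA (octEnc o) (octEnc z)),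
    fun p x => GaussianInt.toComplex (tab2M (octEnc x) (octEnc p)) / 2,
    fun q y => GaussianInt.toComplex (tab2M (octEnc y) (octEnc q)) / 2, fun o p q => ?_⟩
  -- normalise the β-redexes left by instantiating the witnesses, then collapse the `z`-sum
  beta_reduce
  rw [sum_collapse_graph]
  -- the integer-side certificate read in `ℂ`
  have hk := congrArg GaussianInt.toComplex (key64 o p q)
  simp only [map_mul, map_sum, map_intCast, map_ofNat, apply_ite GaussianInt.toComplex, map_neg,
    map_one] at hk
  -- each complex summand is a quarter of the corresponding summand of `hk`
  have h4 : ∀ a b c s : ℂ, a * (b / 2) * (c / 2) * s = (1 / 4 : ℂ) * (a * b * c * s) := by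
    intros
    ring
  rw [octT_complex_eq_octTab]
  simp only [h4, ← Finset.mul_sum, ← hk]
  ring

end OctAsymptoticRank

end Summit.MatrixMultiplication.MatrixMultiplication.Theorems
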